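import Literature.Barriers.SmoothPoincare4.ExoticOpenFourSpaceEmbeddingProofs
import Mathlib.Analysis.Normed.Module.Ball.Homeomorph
import HarnessLib

/-!
# `deMichelisFreedman1992_continuum`: the polar-coordinate family of Thm. 4.1 — the discharge reduced to the §4 no-go for the open balls of one topological radial function

Third proof file of the fact seat of the named fact
`Literature.Barriers.SmoothPoincare4.deMichelisFreedman1992_continuum`
(`ExoticOpenFourSpace.lean`; DeMichelis–Freedman 1992, Thm. 4.1 with Cor. 4.1: continuum many
pairwise non-diffeomorphic open subsets of standard `ℝ⁴`, each homeomorphic to `ℝ⁴`). The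
earlier files prove, bottom-up along the printed proof:

* `ExoticOpenFourSpaceProofs.lean` — Cor. 4.1 in ZFC
  (`deMichelisFreedman1992_continuum_of_countableClasses`) and the third paragraph of the proof
  of Thm. 4.1 (`countable_setOf_nonempty_diffeomorph`, `…_of_core`);
* `ExoticOpenFourSpaceEmbeddingProofs.lean` — the second paragraph of the proof of Thm. 4.1
  (`exists_ne_diffeomorph_apply_eq_of_not_countable`: among uncountably many diffeomorphisms of
  neighbourhoods of a compactum `K` onto a fixed open `M ⊆ ℝ⁴`, two differ on `K` by a
  self-diffeomorphism of `M`), whence `deMichelisFreedman1992_continuum_of_nogo (hcore)`: the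
  fact from the FIRST paragraph alone, `hcore` being stated for an abstract monotone family
  `R : cantorSet → Opens ℝ⁴` of `ℝ⁴`-homeomorphs containing a smooth compact domain `K`.

This file renders the family itself as printed and removes it from the hypothesis. Thm. 4.1
(p. 246): "`R⁴_1` has a topological system of polar coordinates with radial function `ρ` so that
the open balls of radius `r` are 'ribbon 4-spaces' `R⁴_t` in the sense of §3 whenever
`t = 1 - 1/r` belongs to the standard Cantor set `CS ⊂ [0, 1]`", where (§4, first lines) "By a
topological radial function we mean a homeomorphism followed by the usual radius function
`ℝ⁴_std → [0, ∞)`", and (Thm. 3.2, p. 244) the compactum satisfies `K ⊂ R⁴_0` (the open ball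
of radius `1`). Accordingly, for an open `R ⊆ ℝ⁴`, a homeomorphism `e : R ≃ₜ ℝ⁴` (so
`ρ = ‖e ·‖`) and `t ∈ ℝ` we define the open ball of `ρ`-radius `r = 1/(1 - t)`,

  `polarBall R e t = {x ∈ R | (1 - t) · ‖e x‖ < 1}`   (`= R` for `t = 1`, i.e. `r = ∞`),

and PROVE everything Thm. 4.1 asserts about this family short of the gauge theory: the
`polarBall R e t` are open subsets of `ℝ⁴` (`polarBall`), nested (`polarBall_mono`: "a
continuous nested family `R⁴_t`, `R⁴_s ⊂ R⁴_t` for `s < t`", §0), exhaust `R = R⁴_1`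
(`polarBall_one`), contain `K` as soon as `K ⊂ R⁴_0` and `0 ≤ t` (`polarBall_mono`), and each
is homeomorphic to `ℝ⁴` (`nonempty_polarBall_homeomorph`: via `e` it is a round open ball of
`ℝ⁴`, or all of `ℝ⁴`). Consequently (`deMichelisFreedman1992_continuum_of_polar_nogo`) the
discharge `deMichelisFreedman1992_continuum_holds` reduces to the statement printed as the first
paragraph of the proof of Thm. 4.1 (p. 247) about ONE open `ℝ⁴`-homeomorph `R ⊆ ℝ⁴` with polar
coordinates `e` and ONE compactum `K ⊂ R⁴_0` (the output of Thms. 3.1 and 3.2 applied to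
Kotschick's h-cobordism between the Barlow surface and `CP² # 8(-CP²)`): "Suppose there is a
diffeomorphism `(d, id_K) : (R⁴_s, K) → (R⁴_t, K)`, `s ≠ t ∈ CS`. … This leads via Theorem 2.1
to a contradiction" — no diffeomorphism `polarBall R e s → polarBall R e t`, `s ≠ t ∈ CS`,
restricts to the identity on `K`. The compactum is only required to be compact here (the tree's
second-paragraph theorem holds for every compact `K`; the source takes "a smooth codimension
zero submanifold"), which also gives the compact-`K` forms
`countable_setOf_nonempty_diffeomorph_of_isCompact` and
`deMichelisFreedman1992_countableClasses_of_nogo'` of the tree's combination theorems.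

What remains undischarged is exactly that no-go: Kotschick's `Φ`-invariant (§1), Taubes'
end-periodic Yang–Mills theory (Thm. 2.1, App. A, B), Freedman's structure theorem for simply
connected smooth h-cobordisms (Thm. 3.1) and the ribbon radius function (Thm. 3.2) — a theory
absent from Mathlib; no named fact is introduced for it (D-0026).

## References

* S. DeMichelis, M. H. Freedman, *Uncountably many exotic `R⁴`'s in standard 4-space*,
  J. Differential Geom. 35 (1992) 219–254: §0 (p. 220), Thm. 3.2 (p. 244), §4 and Thm. 4.1
  (p. 246), proof of Thm. 4.1 (p. 247), Cor. 4.1 (pp. 247–248) [DeMichelisFreedman1992].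

[DeMichelisFreedman1992]
-/

noncomputable section

open scoped Manifold ContDiff Cardinal
open TopologicalSpace Set Metric

namespace Literature.Barriers.SmoothPoincare4

/-- Local notation: `𝔼 n` is the model Euclidean space `EuclideanSpace ℝ (Fin n)`. -/
local notation "𝔼 " n:arg => EuclideanSpace ℝ (Fin n)

/-! ### The combination step for a compact `K` -/

/-- **Third paragraph of the proof of Thm. 4.1 with the second paragraph discharged, for a
compact `K`.** For any family `R` of open subsets of `ℝ⁴` containing a compact set `K`, if no
diffeomorphism `R s → R t`, `s ≠ t`, restricts to the identity on `K`, then only countably many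
`R t` are diffeomorphic to a given `R s`: the tree's `countable_setOf_nonempty_diffeomorph`
(p. 247, "Combining the previous two paragraphs") fed with the tree's theorem
`exists_ne_diffeomorph_apply_eq_of_not_countable` (the second paragraph, valid for every compact
`K`). [cite: DeMichelisFreedman1992, proof of Thm. 4.1, p. 247] -/
theorem countable_setOf_nonempty_diffeomorph_of_isCompact {ι : Type*} (R : ι → Opens (𝔼 4))
    {K : Set (𝔼 4)} (hK : IsCompact K) (hKR : ∀ t, K ⊆ R t)
    (hno : ∀ s t, s ≠ t → ∀ d : R s ≃ₘ⟮𝓡 4, 𝓡 4⟯ R t,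
      ∃ x : R s, (x : 𝔼 4) ∈ K ∧ ((d x : R t) : 𝔼 4) ≠ x) (s : ι) :
    {t | Nonempty (R t ≃ₘ⟮𝓡 4, 𝓡 4⟯ R s)}.Countable := by
  refine countable_setOf_nonempty_diffeomorph R K hKR s hno fun T hT φ => ?_
  have hT' : ¬ Countable T := by rwa [Set.countable_coe_iff]
  obtain ⟨i, j, hij, h, hh⟩ := exists_ne_diffeomorph_apply_eq_of_not_countable (R s) hK
    (fun t : T => R (t : ι)) φ (fun t => hKR t) hT'
  exact ⟨i, j, hij, h, hh⟩

/-- **The leaf from the no-go alone, compact-`K` form** (the tree's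
`deMichelisFreedman1992_countableClasses_of_nogo` with `IsSmoothCompactDomain K` weakened to
`IsCompact K`). The conclusion — the `CS`-indexed nested family of open `ℝ⁴`-homeomorphs with
countable diffeomorphism classes, Thm. 4.1 — is the statement of the former decomposition child
`deMichelisFreedman1992_countableClasses` of `ExoticOpenFourSpaceProofs`, merged back into this
cone's single proof obligation by its D-0026 review and therefore spelled out.
[cite: DeMichelisFreedman1992, Thm. 4.1 and its proof (pp. 246–247)] -/
theorem deMichelisFreedman1992_countableClasses_of_nogo'
    (hcore : ∃ (R : cantorSet → Opens (𝔼 4)) (K : Set (𝔼 4)), Monotone R ∧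
      (∀ t, Nonempty (R t ≃ₜ 𝔼 4)) ∧ IsCompact K ∧ (∀ t, K ⊆ R t) ∧
      ∀ s t, s ≠ t → ∀ d : R s ≃ₘ⟮𝓡 4, 𝓡 4⟯ R t,
        ∃ x : R s, (x : 𝔼 4) ∈ K ∧ ((d x : R t) : 𝔼 4) ≠ x) :
    ∃ R : cantorSet → Opens (𝔼 4), Monotone R ∧ (∀ t, Nonempty (R t ≃ₜ 𝔼 4)) ∧
      ∀ t, {t' | Nonempty (R t' ≃ₘ⟮𝓡 4, 𝓡 4⟯ R t)}.Countable := by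
  obtain ⟨R, K, hmono, htop, hK, hKR, hno⟩ := hcore
  exact ⟨R, hmono, htop, fun s => countable_setOf_nonempty_diffeomorph_of_isCompact R hK hKR hno s⟩

/-! ### The open balls of a topological radial function (Thm. 4.1, Thm. 3.2) -/

section PolarBall

variable {X : Type*} [TopologicalSpace X] {F : Type*} [SeminormedAddCommGroup F]

/-- **The open ball `R⁴_t` of a topological radial function** (DeMichelis–Freedman, §4: "By a
topological radial function we mean a homeomorphism followed by the usual radius function
`ℝ⁴_std → [0, ∞)`"; Thm. 4.1: "the open balls of radius `r` are … `R⁴_t` … whenever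
`t = 1 - 1/r`"; Thm. 3.2: "`R⁴_t = ρ⁻¹([0, r))`"). For an open `R ⊆ X`, a homeomorphism
`e : R ≃ₜ F` onto a real normed space (polar coordinates on `R`, radial function `ρ = ‖e ·‖`) and
a parameter `t ∈ ℝ`, `polarBall R e t` is the set of points of `R` of `ρ`-radius
`< r = 1/(1 - t)`, written `(1 - t) · ρ < 1` so that `t = 1` (`r = ∞`) gives `R⁴_1 = R` itself;
it is an open subset of `X` (an open subset of the open set `R`). Used with `X = F = ℝ⁴`.
[cite: DeMichelisFreedman1992, §4 and Thm. 4.1 (p. 246); Thm. 3.2 (p. 244)] -/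
def polarBall (R : Opens X) (e : R ≃ₜ F) (t : ℝ) : Opens X where
  carrier := {x | ∃ hx : x ∈ R, (1 - t) * ‖e ⟨x, hx⟩‖ < 1}
  is_open' := by
    have h1 : IsOpen {y : R | (1 - t) * ‖e y‖ < 1} :=
      isOpen_lt (continuous_const.mul (continuous_norm.comp e.continuous)) continuous_const
    have h2 := R.isOpenEmbedding'.isOpenMap _ h1
    convert h2 using 1
    ext x
    constructor
    · rintro ⟨hx, h⟩
      exact ⟨⟨x, hx⟩, h, rfl⟩
    · rintro ⟨y, hy, rfl⟩
      exact ⟨y.2, hy⟩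

variable (R : Opens X) (e : R ≃ₜ F)

/-- Membership in `polarBall R e t`: `x ∈ R` and `(1 - t) · ‖e x‖ < 1`. [folklore] -/
theorem mem_polarBall {t : ℝ} {x : X} :
    x ∈ polarBall R e t ↔ ∃ hx : x ∈ R, (1 - t) * ‖e ⟨x, hx⟩‖ < 1 :=
  Iff.rfl

/-- Membership of a point of `R` in `polarBall R e t`. [folklore] -/
theorem coe_mem_polarBall {t : ℝ} {x : R} : (x : X) ∈ polarBall R e t ↔ (1 - t) * ‖e x‖ < 1 :=
  ⟨fun ⟨_, h⟩ => h, fun h => ⟨x.2, h⟩⟩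

/-- Membership in the unit ball `R⁴_0`: `‖e x‖ < 1`. [folklore] -/
theorem mem_polarBall_zero {x : X} : x ∈ polarBall R e 0 ↔ ∃ hx : x ∈ R, ‖e ⟨x, hx⟩‖ < 1 := by
  simp only [mem_polarBall, sub_zero, one_mul]

/-- The balls `R⁴_t` lie in `R`. [folklore] -/
theorem polarBall_le (t : ℝ) : polarBall R e t ≤ R := fun _ hx =>
  ((mem_polarBall R e).1 hx).1

/-- **The family is nested**: `R⁴_s ⊆ R⁴_t` for `s ≤ t` ("a continuous nested family `R⁴_t` …
with `R⁴_s ⊂ R⁴_t` for `s < t`", §0, p. 220). [cite: DeMichelisFreedman1992, §0 (p. 220)] -/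
theorem polarBall_mono {s t : ℝ} (hst : s ≤ t) : polarBall R e s ≤ polarBall R e t := by
  intro x hx
  obtain ⟨hxR, h⟩ := (mem_polarBall R e).1 hx
  refine (mem_polarBall R e).2 ⟨hxR, lt_of_le_of_lt ?_ h⟩
  exact mul_le_mul_of_nonneg_right (by linarith) (norm_nonneg _)

/-- `R⁴_1 = R`: the ball of infinite radius (`t = 1`) is the whole of `R` (Thm. 4.1 names the
exotic `ℝ⁴` itself `R⁴_1`). [cite: DeMichelisFreedman1992, Thm. 4.1 (p. 246)] -/
theorem polarBall_one : polarBall R e 1 = R := by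
  ext x
  simp only [SetLike.mem_coe, mem_polarBall, sub_self, zero_mul, zero_lt_one, exists_prop,
    and_true]

/-- The preimage of `0` under the polar coordinates (the centre) lies in every `R⁴_t`; in
particular the balls are nonempty. [folklore] -/
theorem symm_zero_mem_polarBall (t : ℝ) : (e.symm 0 : X) ∈ polarBall R e t :=
  (coe_mem_polarBall R e).2 (by simp)

/-- `R⁴_t` is homeomorphic, by restriction of the polar coordinates `e`, to the subset
`{y | (1 - t) · ‖y‖ < 1}` of `F`. [folklore] -/
def polarBallHomeomorph (t : ℝ) : polarBall R e t ≃ₜ {y : F // (1 - t) * ‖y‖ < 1} :=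
  (show polarBall R e t ≃ₜ {y : R // (1 - t) * ‖e y‖ < 1} from
    { toFun := fun x => ⟨⟨x, ((mem_polarBall R e).1 x.2).1⟩, ((mem_polarBall R e).1 x.2).2⟩
      invFun := fun y => ⟨(y.1 : X), (mem_polarBall R e).2 ⟨y.1.2, y.2⟩⟩
      left_inv := fun _ => rfl
      right_inv := fun _ => rfl
      continuous_toFun := (continuous_subtype_val.subtype_mk _).subtype_mk _
      continuous_invFun := (continuous_subtype_val.comp continuous_subtype_val).subtype_mk _ }).trans
    (e.subtype fun _ => Iff.rfl)

/-- `polarBallHomeomorph` is the restriction of the polar coordinates `e`. [folklore] -/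
@[simp] theorem polarBallHomeomorph_apply_coe (t : ℝ) (x : polarBall R e t) :
    (polarBallHomeomorph R e t x : F) = e ⟨x, ((mem_polarBall R e).1 x.2).1⟩ :=
  rfl

variable [NormedSpace ℝ F]

variable (F) in
/-- The subset `{y | (1 - t) · ‖y‖ < 1}` of a real normed space is all of it for `t ≥ 1` and the
open ball of radius `1/(1 - t)` about `0` for `t < 1`; either way it is homeomorphic to the whole
space (Mathlib's `OpenPartialHomeomorph.univBall`). [folklore] -/
theorem nonempty_homeomorph_setOf_mul_norm_lt (t : ℝ) :
    Nonempty ({y : F // (1 - t) * ‖y‖ < 1} ≃ₜ F) := by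
  rcases le_or_gt 1 t with ht | ht
  · have hS : {y : F | (1 - t) * ‖y‖ < 1} = univ := by
      refine eq_univ_of_forall fun y => ?_
      show (1 - t) * ‖y‖ < 1
      nlinarith [norm_nonneg y]
    exact ⟨(Homeomorph.setCongr hS).trans (Homeomorph.Set.univ F)⟩
  · have hr : 0 < 1 / (1 - t) := one_div_pos.mpr (by linarith)
    have hS : {y : F | (1 - t) * ‖y‖ < 1} = ball (0 : F) (1 / (1 - t)) := by
      ext y
      rw [mem_setOf_eq, mem_ball_zero_iff, lt_div_iff₀ (by linarith : (0 : ℝ) < 1 - t), mul_comm]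
    have hsrc : (OpenPartialHomeomorph.univBall (0 : F) (1 / (1 - t))).source = univ :=
      OpenPartialHomeomorph.univBall_source _ _
    have htgt : (OpenPartialHomeomorph.univBall (0 : F) (1 / (1 - t))).target =
        ball (0 : F) (1 / (1 - t)) :=
      OpenPartialHomeomorph.univBall_target _ hr
    exact ⟨(Homeomorph.setCongr (hS.trans htgt.symm)).trans
      ((OpenPartialHomeomorph.univBall (0 : F) (1 / (1 - t))).toHomeomorphSourceTarget.symm.trans
        ((Homeomorph.setCongr hsrc).trans (Homeomorph.Set.univ F)))⟩

/-- **Each `R⁴_t` is homeomorphic to the model space** (an open ball of "a topological system of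
polar coordinates", Thm. 4.1). [cite: DeMichelisFreedman1992, Thm. 4.1 (p. 246)] -/
theorem nonempty_polarBall_homeomorph (t : ℝ) : Nonempty (polarBall R e t ≃ₜ F) := by
  obtain ⟨f⟩ := nonempty_homeomorph_setOf_mul_norm_lt F t
  exact ⟨(polarBallHomeomorph R e t).trans f⟩

end PolarBall

/-! ### Thm. 4.1 and the tree's fact from the §4 no-go for the polar family -/

/-- **DeMichelis–Freedman 1992, Thm. 4.1 (the leaf: the `CS`-indexed nested family of open
`ℝ⁴`-homeomorphs with countable diffeomorphism classes) from the first paragraph of its proof,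
stated for the printed family.** Suppose given an open
`R ⊆ ℝ⁴` with a topological system of polar coordinates `e : R ≃ₜ ℝ⁴` and a compact `K`
inside the unit ball `R⁴_0` of the radial function `‖e ·‖` ("`K ⊂ R⁴_0`", Thm. 3.2; the output
of Thms. 3.1, 3.2) such that for `s ≠ t ∈ CS` no diffeomorphism `R⁴_s → R⁴_t` of the open balls
`R⁴_t = polarBall R e t` (open subsets of `ℝ⁴`, smooth structure by restriction) restricts to
the identity on `K` (p. 247: "Suppose there is a diffeomorphism
`(d, id_K) : (R⁴_s, K) → (R⁴_t, K)`, `s ≠ t ∈ CS`. As in the introduction, this allows the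
construction of end periodic metrics … This leads via Theorem 2.1 to a contradiction and the
conclusion that if there is a diffeomorphism `d : R⁴_s → R⁴_t`, then `d` restricted to `K` is
not the identity"). Then `t ↦ R⁴_t`, `t ∈ CS`, is a monotone family of open `ℝ⁴`-homeomorphs
in `ℝ⁴` with countable diffeomorphism classes — the leaf — by the proved second and third
paragraphs (`countable_setOf_nonempty_diffeomorph_of_isCompact`). The compactum is "a smooth
codimension zero submanifold" in the source; compactness is all that is used.
[cite: DeMichelisFreedman1992, Thm. 4.1 (p. 246) and its proof (p. 247); Thm. 3.2 (p. 244)] -/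
theorem deMichelisFreedman1992_countableClasses_of_polar_nogo
    (h : ∃ (R : Opens (𝔼 4)) (e : R ≃ₜ 𝔼 4) (K : Set (𝔼 4)), IsCompact K ∧
      K ⊆ polarBall R e 0 ∧
      ∀ s t : cantorSet, s ≠ t →
        ∀ d : polarBall R e (s : ℝ) ≃ₘ⟮𝓡 4, 𝓡 4⟯ polarBall R e (t : ℝ),
          ∃ x : polarBall R e (s : ℝ), (x : 𝔼 4) ∈ K ∧
            ((d x : polarBall R e (t : ℝ)) : 𝔼 4) ≠ x) :
    ∃ R : cantorSet → Opens (𝔼 4), Monotone R ∧ (∀ t, Nonempty (R t ≃ₜ 𝔼 4)) ∧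
      ∀ t, {t' | Nonempty (R t' ≃ₘ⟮𝓡 4, 𝓡 4⟯ R t)}.Countable := by
  obtain ⟨R, e, K, hK, hK0, hno⟩ := h
  have hKR : ∀ t : cantorSet, K ⊆ polarBall R e (t : ℝ) := fun t =>
    hK0.trans (polarBall_mono R e (cantorSet_subset_unitInterval t.2).1)
  refine ⟨fun t => polarBall R e (t : ℝ), fun s t hst => polarBall_mono R e hst,
    fun t => nonempty_polarBall_homeomorph R e (t : ℝ), fun s => ?_⟩
  exact countable_setOf_nonempty_diffeomorph_of_isCompact (fun t : cantorSet => polarBall R e t)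
    hK hKR hno s

/-- **The tree's fact `deMichelisFreedman1992_continuum` from the §4 no-go for the polar family
of ONE open `ℝ⁴`-homeomorph `R ⊆ ℝ⁴` with compactum `K ⊂ R⁴_0`** (through Thm. 4.1,
`deMichelisFreedman1992_countableClasses_of_polar_nogo`, and Cor. 4.1,
`deMichelisFreedman1992_continuum_of_countableClasses`). The discharge
`deMichelisFreedman1992_continuum_holds` is this theorem applied to the output of Thms. 3.1, 3.2
for Kotschick's h-cobordism and the `Φ`-invariant contradiction of §4 (Thm. 2.1) — the part of
the source that is a theory absent from Mathlib. [cite: DeMichelisFreedman1992, Thm. 4.1, Cor. 4.1 and their proofs (pp. 246–248)] -/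
theorem deMichelisFreedman1992_continuum_of_polar_nogo
    (h : ∃ (R : Opens (𝔼 4)) (e : R ≃ₜ 𝔼 4) (K : Set (𝔼 4)), IsCompact K ∧
      K ⊆ polarBall R e 0 ∧
      ∀ s t : cantorSet, s ≠ t →
        ∀ d : polarBall R e (s : ℝ) ≃ₘ⟮𝓡 4, 𝓡 4⟯ polarBall R e (t : ℝ),
          ∃ x : polarBall R e (s : ℝ), (x : 𝔼 4) ∈ K ∧
            ((d x : polarBall R e (t : ℝ)) : 𝔼 4) ≠ x) :
    deMichelisFreedman1992_continuum :=
  deMichelisFreedman1992_continuum_of_countableClasses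
    (deMichelisFreedman1992_countableClasses_of_polar_nogo h)

/-- The barrier `OpenAnalogueBarrierFour` from the same no-go. [cite: DeMichelisFreedman1992, Thm. 4.1 and Cor. 4.1] -/
theorem openAnalogueBarrierFour_of_polar_nogo
    (h : ∃ (R : Opens (𝔼 4)) (e : R ≃ₜ 𝔼 4) (K : Set (𝔼 4)), IsCompact K ∧
      K ⊆ polarBall R e 0 ∧
      ∀ s t : cantorSet, s ≠ t →
        ∀ d : polarBall R e (s : ℝ) ≃ₘ⟮𝓡 4, 𝓡 4⟯ polarBall R e (t : ℝ),
          ∃ x : polarBall R e (s : ℝ), (x : 𝔼 4) ∈ K ∧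
            ((d x : polarBall R e (t : ℝ)) : 𝔼 4) ≠ x) :
    OpenAnalogueBarrierFour :=
  openAnalogueBarrierFour_of_deMichelisFreedman (deMichelisFreedman1992_continuum_of_polar_nogo h)

end Literature.Barriers.SmoothPoincare4

end
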